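import Mathlib
import Summits.KontsevichZagierPeriods.KontsevichZagierPeriods.Theorems.SoloInformedKZStokesCube
import HarnessLib
import HarnessLib.Audit

/-!
# SoloInformed — Ayoub's presentation of the ring of periods, typed over the KZ calculus

J. Ayoub, *Periods and the conjectures of Grothendieck and Kontsevich–Zagier*, EMS Newsletter 91
(2014) 12–18, §2.2 (read at Definition 9, Definition 10, Proposition 11, Remarks 12–13):
`𝒪_alg(𝔻ⁿ)` is the `ℚ`-vector space of power series in `z₁, …, zₙ` with radius of convergence `> 1`
which are algebraic over `ℚ(z₁, …, zₙ)`; `𝒪_alg(𝔻^∞) = ⋃ₙ 𝒪_alg(𝔻ⁿ)`; `𝒫^eff` is the quotient of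
`𝒪_alg(𝔻^∞)` by the span of the *Stokes elements* `∂f/∂zᵢ − f|_{zᵢ=1} + f|_{zᵢ=0}`; the evaluation
`Ev [f] = ∫_{[0,1]ⁿ} f`; and "we may restate the Kontsevich–Zagier conjecture in more elementary
terms … as follows: the evaluation homomorphism (7) is injective" (Remark 13, stated for
`𝒫 = 𝒫^eff[(2πi)⁻¹]`).

This file TYPES these objects so that the transfer to the KZ calculus
(`SoloInformedAyoubTransfer.lean`) can be kernel-checked:

* `SoloInformedAyoubGen n` — a generator: `f : ℂⁿ → ℂ` analytic on an open polydisc `‖z‖_∞ < ρ`,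
  `ρ > 1`, satisfying a non-zero polynomial identity `P(z, f z) = 0`, `P ∈ ℚ[z₁, …, zₙ, T]`, and
  REAL on the real points of the polydisc (we present the sub-`ℤ`-module of `𝒫^eff` spanned by
  the power series with real coefficients — all the KZ side needs; see `SoloInformedAyoubKZeff`);
* `SoloInformedAyoubSymbols` — the free abelian group on all generators, `soloInformedAyoubEv` its
  evaluation `[f] ↦ ∫_{[0,1]ⁿ} f`;
* `soloInformedAyoubRel` — the subgroup generated by (E) `[a] − [b]` for `a = b` on the real cube
  (a uniqueness set, so this identifies equal power series), (A) `[a + b] − [a] − [b]` (the vector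
  space structure of `𝒪_alg`), (I) `[a ∘ init] − [a]` (the inclusions `𝒪(𝔻ⁿ) ⊂ 𝒪(𝔻ⁿ⁺¹)` of the
  union `𝒪_alg(𝔻^∞)`), (S) the Stokes elements — so that `Symbols ⧸ Rel` is Ayoub's `𝒫^eff` as an
  additive group;
* `SoloInformedAyoubKZeff` — injectivity of `Ev` on `𝒫^eff` (the EFFECTIVE form of Remark 13;
  Ayoub's printed form is on the localisation `𝒫^eff[(2πi)⁻¹]`; the two agree when `2πi` is a
  non-zero-divisor of `𝒫^eff`, which we do NOT assume silently: the hypothesis used downstream is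
  exactly `SoloInformedAyoubKZeff`);
* `SoloInformedAyoubLemmaQ` — `ℚ`-semialgebraicity of `Re f` on an open neighbourhood of the real
  cube (true by a `ℚ`-cylindrical decomposition adapted to `P`; recorded as a named statement, to be
  proved separately);
* `SoloInformedAyoubPresentation` — THEOREM P_A of the solo-informed programme (presentation of
  every integral representation, up to a positive multiple and the KZ moves, by cube integrals of
  real parts of Ayoub generators real on the cube) — the load-bearing open statement of the line.
-/

noncomputable section

open scoped BigOperators
open Set MeasureTheory
open Literature.NumberTheory.Transcendental Literature.NumberTheory.Transcendental.KZ

namespace Summit.KontsevichZagierPeriods.KontsevichZagierPeriods.Theorems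

/-! ### Real points of `ℂⁿ` -/

/-- The inclusion `ℝⁿ → ℂⁿ`, `x ↦ (x₁, …, xₙ)` as a real continuous linear map. -/
def soloInformedToC (n : ℕ) : (Fin n → ℝ) →L[ℝ] (Fin n → ℂ) :=
  ContinuousLinearMap.pi fun j => Complex.ofRealCLM.comp (ContinuousLinearMap.proj j)

/-- Coordinates of `soloInformedToC`. -/
@[simp] theorem soloInformedToC_apply (n : ℕ) (x : Fin n → ℝ) (j : Fin n) :
    soloInformedToC n x j = (x j : ℂ) := rfl

/-- `soloInformedToC` maps the basis vector `eᵢ` of `ℝⁿ` to the basis vector `eᵢ` of `ℂⁿ`. -/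
theorem soloInformedToC_single {n : ℕ} (i : Fin n) :
    soloInformedToC n (Pi.single i 1) = Pi.single i 1 := by
  ext j
  by_cases h : j = i
  · subst h; simp
  · simp [h]

/-! ### Ayoub's generators -/

/-- A generator of Ayoub's `𝒪_alg(𝔻ⁿ)`: a function `f : ℂⁿ → ℂ` analytic on the open polydisc
`{‖z‖_∞ < ρ}` of some radius `ρ > 1` (a power series with radius of convergence `> 1`) which is
algebraic over `ℚ(z₁, …, zₙ)`: `P(z, f z) = 0` on the polydisc for a non-zero `P ∈ ℚ[z₁, …, zₙ, T]`
(last variable `T`). [Ayoub 2014, Def. 9] -/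
structure SoloInformedAyoubGen (n : ℕ) where
  /-- the function -/
  f : (Fin n → ℂ) → ℂ
  /-- the radius of the polydisc of convergence -/
  ρ : ℝ
  /-- the radius exceeds `1` -/
  one_lt : 1 < ρ
  /-- analyticity on the open polydisc (sup norm) -/
  analytic : AnalyticOnNhd ℂ f (Metric.ball 0 ρ)
  /-- `f` is real on the real points of the polydisc (real sub-presentation, see the docstring of
  `SoloInformedAyoubKZeff`) -/
  real : ∀ x : Fin n → ℝ, soloInformedToC n x ∈ Metric.ball (0 : Fin n → ℂ) ρ →
    (f (soloInformedToC n x)).im = 0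
  /-- algebraicity over `ℚ(z₁, …, zₙ)` -/
  algebraic : ∃ P : MvPolynomial (Fin (n + 1)) ℚ, P ≠ 0 ∧
    ∀ z ∈ Metric.ball (0 : Fin n → ℂ) ρ, MvPolynomial.aeval (Fin.snoc z (f z)) P = 0

/-- The symbols: the free abelian group on all generators of all dimensions. -/
abbrev SoloInformedAyoubSymbols : Type := FreeAbelianGroup (Σ n, SoloInformedAyoubGen n)

/-- The symbol `[a]` of a generator. -/
def soloInformedAyoubOf {n : ℕ} (a : SoloInformedAyoubGen n) : SoloInformedAyoubSymbols :=
  FreeAbelianGroup.of ⟨n, a⟩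

/-- Evaluation `[f] ↦ ∫_{[0,1]ⁿ} f` (Bochner integral over the real unit cube).
[Ayoub 2014, Rem. 13] -/
def soloInformedAyoubEv : SoloInformedAyoubSymbols →+ ℂ :=
  FreeAbelianGroup.lift fun a => ∫ x in soloInformedCube a.1, a.2.f (soloInformedToC a.1 x)

/-- `Ev [a] = ∫_{[0,1]ⁿ} a`. -/
@[simp] theorem soloInformedAyoubEv_of {n : ℕ} (a : SoloInformedAyoubGen n) :
    soloInformedAyoubEv (soloInformedAyoubOf a) =
      ∫ x in soloInformedCube n, a.f (soloInformedToC n x) :=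
  FreeAbelianGroup.lift_apply_of _ _

/-! ### The relations: `Symbols ⧸ Rel = 𝒫^eff` -/

/-- (E) extensionality: generators agreeing on the real cube `[0,1]ⁿ` (a set of uniqueness for
analytic functions on the polydisc) have the same symbol. -/
def soloInformedAyoubExtRel : Set SoloInformedAyoubSymbols :=
  {c | ∃ (n : ℕ) (a b : SoloInformedAyoubGen n),
    (∀ x ∈ soloInformedCube n, a.f (soloInformedToC n x) = b.f (soloInformedToC n x)) ∧
    c = soloInformedAyoubOf a - soloInformedAyoubOf b}

/-- (A) additivity: `[a + b] = [a] + [b]` (the vector-space structure of `𝒪_alg(𝔻ⁿ)`). -/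
def soloInformedAyoubAddRel : Set SoloInformedAyoubSymbols :=
  {c | ∃ (n : ℕ) (a b s : SoloInformedAyoubGen n),
    (∀ x ∈ soloInformedCube n,
      s.f (soloInformedToC n x) = a.f (soloInformedToC n x) + b.f (soloInformedToC n x)) ∧
    c = soloInformedAyoubOf s - soloInformedAyoubOf a - soloInformedAyoubOf b}

/-- (I) the inclusions `𝒪(𝔻ⁿ) ⊂ 𝒪(𝔻ⁿ⁺¹)`, `a ↦ a ∘ init`, of the union `𝒪_alg(𝔻^∞)`.
[Ayoub 2014, Def. 9] -/
def soloInformedAyoubInitRel : Set SoloInformedAyoubSymbols :=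
  {c | ∃ (n : ℕ) (a : SoloInformedAyoubGen n) (e : SoloInformedAyoubGen (n + 1)),
    (∀ x ∈ soloInformedCube (n + 1),
      e.f (soloInformedToC (n + 1) x) = a.f (soloInformedToC n (Fin.init x))) ∧
    c = soloInformedAyoubOf e - soloInformedAyoubOf a}

/-- (S) the Stokes elements `[∂a/∂zᵢ] − [a|_{zᵢ=1}] + [a|_{zᵢ=0}]`. [Ayoub 2014, Def. 10] -/
def soloInformedAyoubStokesRel : Set SoloInformedAyoubSymbols :=
  {c | ∃ (n : ℕ) (i : Fin (n + 1)) (a b : SoloInformedAyoubGen (n + 1))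
      (t s : SoloInformedAyoubGen n),
    (∀ x ∈ soloInformedCube (n + 1), b.f (soloInformedToC (n + 1) x) =
      fderiv ℂ a.f (soloInformedToC (n + 1) x) (Pi.single i 1)) ∧
    (∀ y ∈ soloInformedCube n,
      t.f (soloInformedToC n y) = a.f (soloInformedToC (n + 1) (Fin.insertNth i 1 y))) ∧
    (∀ y ∈ soloInformedCube n,
      s.f (soloInformedToC n y) = a.f (soloInformedToC (n + 1) (Fin.insertNth i 0 y))) ∧
    c = soloInformedAyoubOf b - soloInformedAyoubOf t + soloInformedAyoubOf s}

/-- The subgroup of relations; `SoloInformedAyoubSymbols ⧸ soloInformedAyoubRel` is Ayoub's `𝒫^eff`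
as an additive group. [Ayoub 2014, Def. 10] -/
def soloInformedAyoubRel : AddSubgroup SoloInformedAyoubSymbols :=
  AddSubgroup.closure (soloInformedAyoubExtRel ∪ soloInformedAyoubAddRel ∪
    soloInformedAyoubInitRel ∪ soloInformedAyoubStokesRel)

/-! ### The three named statements -/

/-- **Ayoub's form of the Kontsevich–Zagier conjecture, effective version, real generators**: the
evaluation `Ev` is injective on `𝒫^eff_ℝ := ℤ[real generators] ⧸ ⟨(E), (A), (I), (S) among real
generators⟩`, i.e. a formal combination of real generators with integral `0` is a combination of the
relations. It FOLLOWS from injectivity on Ayoub's full `𝒫^eff` (complex power series): the averaging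
`f ↦ (f + f̄)/2`, `f̄(z) = conj (f (conj z))`, sends generators to real generators, fixes the real
ones (identity theorem), and maps each instance of (E), (A), (I), (S) to an instance among real
generators (it commutes with `∂/∂zᵢ`, with the face restrictions and with `init`). OPEN (a form of
the period conjecture); registered as an open statement, used downstream only as an explicit
hypothesis `(h : SoloInformedAyoubKZeff)`. [cite: Ayoub2014, Conj. 7 with Rem. 13 and Prop. 11] -/
@[conjecture] def SoloInformedAyoubKZeff : Prop :=
  ∀ x : SoloInformedAyoubSymbols, soloInformedAyoubEv x = 0 → x ∈ soloInformedAyoubRel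

/-- **LEMMA Q** (`ℚ`-definability of real parts of Ayoub generators): for every generator `a`
there is an open `W ⊇ [0,1]ⁿ` of real points inside the polydisc of convergence on which
`x ↦ Re a(x)` is a `ℚ`-semialgebraic function. True (a `ℚ`-cylindrical decomposition adapted to
the polynomial `P` of `a` has continuous `ℚ`-semialgebraic root sections, and a continuous root
selection over a connected cell is one section); registered as a named open statement of the
tree until its proof (from `soloInformed_isSemialgebraicFunOn_of_aeval_eq_zero`,
`SoloInformedNashSelection.lean`) lands; used here only as an explicit hypothesis.
[cite: BasuPollackRoy2006, Cor. 5.7] [cite: Ayoub2014, Def. 9] -/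
@[conjecture] def SoloInformedAyoubLemmaQ : Prop :=
  ∀ (n : ℕ) (a : SoloInformedAyoubGen n), ∃ W : Set (Fin n → ℝ), IsOpen W ∧ soloInformedCube n ⊆ W ∧
    MapsTo (soloInformedToC n) W (Metric.ball 0 a.ρ) ∧
    IsSemialgebraicFunOn ℚ W (fun x => (a.f (soloInformedToC n x)).re)

/-- **THEOREM P_A (presentation by moves onto Ayoub generators)** — the OPEN, load-bearing statement
of the line: every integral representation `r` of the KZ calculus is, up to a positive multiple and
modulo the KZ moves, a `ℤ`-combination of cube integrals `[[0,1]^d, Re a]` of (real) Ayoub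
generators `a`. (Expected proof: `ℚ`-cell decomposition, cylindrical Nash parametrisation of
cells by open cubes, boundary resolution by `ℚ`-embedded resolution and power substitutions,
subdivision to push complex singularities off the unit polydisc — each step a list of KZ moves.)
Registered as an open statement; used only as an explicit hypothesis.
[cite: Ayoub2014, Prop. 11 and Rem. 12 (the geometric comparison it replaces)] -/
@[conjecture] def SoloInformedAyoubPresentation : Prop :=
  ∀ (n : ℕ) (r : IntegralRep n), ∃ (k : ℕ) (_ : k ≠ 0) (m : ℕ) (d : Fin m → ℕ)
    (a : ∀ j, SoloInformedAyoubGen (d j)) (c : Fin m → ℤ) (ρ : ∀ j, IntegralRep (d j)),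
    (∀ j, (ρ j).domain = soloInformedCube (d j)) ∧
    (∀ j, EqOn (ρ j).integrand (fun x => ((a j).f (soloInformedToC (d j) x)).re)
      (soloInformedCube (d j))) ∧
    k • of r - ∑ j, c j • of (ρ j) ∈ relations

/-! ### Elementary consequences -/

/-- The four relation families lie in `soloInformedAyoubRel`. -/
theorem soloInformedAyoub_subset_rel :
    soloInformedAyoubExtRel ⊆ soloInformedAyoubRel ∧
    soloInformedAyoubAddRel ⊆ soloInformedAyoubRel ∧
    soloInformedAyoubInitRel ⊆ soloInformedAyoubRel ∧
    soloInformedAyoubStokesRel ⊆ (soloInformedAyoubRel : Set SoloInformedAyoubSymbols) :=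
  ⟨fun _ h => AddSubgroup.subset_closure (Or.inl (Or.inl (Or.inl h))),
    fun _ h => AddSubgroup.subset_closure (Or.inl (Or.inl (Or.inr h))),
    fun _ h => AddSubgroup.subset_closure (Or.inl (Or.inr h)),
    fun _ h => AddSubgroup.subset_closure (Or.inr h)⟩

/-- The real part of an Ayoub generator is `C¹` (indeed real-analytic) on any set of real points
mapped into the polydisc of convergence. -/
theorem soloInformedAyoub_contDiffOn_re {n : ℕ} (a : SoloInformedAyoubGen n) {W : Set (Fin n → ℝ)}
    (hW : MapsTo (soloInformedToC n) W (Metric.ball 0 a.ρ)) :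
    ContDiffOn ℝ 1 (fun x => (a.f (soloInformedToC n x)).re) W := by
  have h1 : ContDiffOn ℝ 1 a.f (Metric.ball 0 a.ρ) :=
    (a.analytic.contDiffOn_of_completeSpace).restrict_scalars ℝ
  have h2 : ContDiffOn ℝ 1 (fun x => a.f (soloInformedToC n x)) W :=
    h1.comp (soloInformedToC n).contDiff.contDiffOn hW
  exact Complex.reCLM.contDiff.comp_contDiffOn h2

/-- The real derivative of `x ↦ Re a(x)` in the direction `eᵢ` at a real point is the real part of
the complex partial derivative `∂a/∂zᵢ`. -/
theorem soloInformedAyoub_fderiv_re {n : ℕ} (a : SoloInformedAyoubGen n) {x : Fin n → ℝ}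
    (hx : soloInformedToC n x ∈ Metric.ball 0 a.ρ) (i : Fin n) :
    fderiv ℝ (fun y => (a.f (soloInformedToC n y)).re) x (Pi.single i 1) =
      (fderiv ℂ a.f (soloInformedToC n x) (Pi.single i 1)).re := by
  have hd : HasFDerivAt a.f (fderiv ℂ a.f (soloInformedToC n x)) (soloInformedToC n x) :=
    ((a.analytic _ hx).differentiableAt).hasFDerivAt
  have h1 : HasFDerivAt (fun y => a.f (soloInformedToC n y))
      (((fderiv ℂ a.f (soloInformedToC n x)).restrictScalars ℝ).comp (soloInformedToC n)) x :=
    (hd.restrictScalars ℝ).comp x (soloInformedToC n).hasFDerivAt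
  have h2 : HasFDerivAt (fun y => (a.f (soloInformedToC n y)).re)
      (Complex.reCLM.comp
        (((fderiv ℂ a.f (soloInformedToC n x)).restrictScalars ℝ).comp (soloInformedToC n))) x :=
    Complex.reCLM.hasFDerivAt.comp x h1
  rw [h2.fderiv]
  simp only [ContinuousLinearMap.comp_apply, ContinuousLinearMap.coe_restrictScalars',
    Complex.reCLM_apply, soloInformedToC_single]

/-- Continuity of an Ayoub generator along real points mapped into the polydisc. -/
theorem soloInformedAyoub_continuousOn {n : ℕ} (a : SoloInformedAyoubGen n) {W : Set (Fin n → ℝ)}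
    (hW : MapsTo (soloInformedToC n) W (Metric.ball 0 a.ρ)) :
    ContinuousOn (fun x => a.f (soloInformedToC n x)) W :=
  a.analytic.continuousOn.comp (soloInformedToC n).continuous.continuousOn hW

/-- The cube is a measurable set. -/
theorem measurableSet_soloInformedCube (n : ℕ) : MeasurableSet (soloInformedCube n) :=
  (isCompact_soloInformedCube n).isClosed.measurableSet

/-- `Re (Ev [a]) = ∫_{[0,1]ⁿ} Re a` for a generator continuous on the cube. -/
theorem soloInformedAyoubEv_of_re {n : ℕ} (a : SoloInformedAyoubGen n)
    (hc : ContinuousOn (fun x => a.f (soloInformedToC n x)) (soloInformedCube n)) :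
    (soloInformedAyoubEv (soloInformedAyoubOf a)).re =
      ∫ x in soloInformedCube n, (a.f (soloInformedToC n x)).re := by
  rw [soloInformedAyoubEv_of]
  exact (integral_re (hc.integrableOn_compact (isCompact_soloInformedCube n))).symm

/-- `Im (Ev [a]) = 0` for a generator real on the real cube. -/
theorem soloInformedAyoubEv_of_im_eq_zero {n : ℕ} (a : SoloInformedAyoubGen n)
    (hc : ContinuousOn (fun x => a.f (soloInformedToC n x)) (soloInformedCube n))
    (hreal : ∀ x ∈ soloInformedCube n, (a.f (soloInformedToC n x)).im = 0) :
    (soloInformedAyoubEv (soloInformedAyoubOf a)).im = 0 := by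
  have hi : IntegrableOn (fun x => a.f (soloInformedToC n x)) (soloInformedCube n) volume :=
    hc.integrableOn_compact (isCompact_soloInformedCube n)
  have h := integral_im (𝕜 := ℂ) hi
  have h0 : ∫ x in soloInformedCube n, RCLike.im (a.f (soloInformedToC n x)) = 0 := by
    rw [setIntegral_congr_fun (measurableSet_soloInformedCube n) (g := fun _ => (0 : ℝ))
      fun x hx => by simpa using hreal x hx]
    simp
  rw [soloInformedAyoubEv_of]
  change RCLike.im (∫ x in soloInformedCube n, a.f (soloInformedToC n x)) = 0
  rw [← h, h0]

end Summit.KontsevichZagierPeriods.KontsevichZagierPeriods.Theorems
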